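import Literature.Claims.NS.UmarBisandu2025
import HarnessLib

/-!
# C60 `UmarBisandu2025` (D-0090 NS-CLAIMS SWEEP, T3 QUICK tranche) — Step 1 («every force term is a constant») is false

M. Umar Bisandu, *Existence and smoothness of the Navier–Stokes equation in three dimensions: a complete
mathematical proof* (2025; bib `UmarBisandu2025NSMinimumForce`). Preliminaries p. 2 + Lemma 1 (10)–(12) p. 3
(+ Lemma 4 p. 4) assert that each force-per-volume term of the momentum equation — `ρ Du/Dt`, `∇P`, `μ∇²u` — is a
constant `(1/F₀)[n_Ω − C_Ω]`; the skeleton (p484315, typist-6 g2) types this as `Step1_MinimumForce` (∃ a constant,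
for ALL smooth `(u, p)` on `[0,∞) × ℝ³`), the first step consumed by `claim_of_steps`.

Kernel facts (pure calculus, no Navier–Stokes theory):
* `not_Step1_MinimumForce` — for the accelerating space-constant flow `u(t,x) = t²·e₀`, `p ≡ 0`, `ρ = μ = 1`, the
  momentum force `ρ Du/Dt = 2t·e₀` is `0` at `t = 0` and `2e₀ ≠ 0` at `t = 1`: not a constant.
* `step3_Bridge_holds` — consequently the typed bridge `Step1 ∧ Step2 → ClaimedTheorem` holds VACUOUSLY (skeleton
  `step3_of_not_step1`): the printed chain transmits nothing to `ClaimedTheorem := clayPeriodic.Regularity`.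
Step 2 (`Step2_ExplicitField`: `μΔ` of `K'x²y²z²/(y²z²+x²z²+x²y²)` constant off the coordinate planes) is false on
paper (`Δu/K' = −Δh/h² + 2|∇h|²/h³` with `h = x⁻²+y⁻²+z⁻²` gives `−10/9` at `(1,1,1)` and `≈ −1.029` at `(1,1,2)`)
and is not kernel-checked here (QUICK row; the first failing step is Step 1).

Authorship: typist-6 g2's kit (sha16 4cc23a399baa6ea6: `e0`, `uAcc`, `momentumForce_uAcc`, `not_Step1_MinimumForce`)
adopted by the refuter of record (refuter-7) with statement types written out in full, docstrings and the vacuity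
record; filed unchanged by the salvage seat (cell convention (b)).

WHAT THIS IS NOT: not a claim about NS regularity or blow-up; not a claim about any author beyond
the typed locator.
-/

set_option linter.dupNamespace false

noncomputable section

open Set
open Literature.Analysis.FluidPDE Literature.Claims.NS.ClayVariants Literature.Claims.NS.UmarBisandu2025

namespace Summit.NavierStokesRegularity.NavierStokesRegularity.Theorems.UmarBisandu2025

/-- The first basis vector `e₀` of `ℝ³`. -/
def e0 : EuclideanSpace ℝ (Fin 3) := EuclideanSpace.single 0 1

/-- `e₀ ≠ 0` (its `0`-th coordinate is `1`). -/
theorem e0_ne_zero : e0 ≠ 0 := by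
  intro h
  have := congrArg (fun v : EuclideanSpace ℝ (Fin 3) => v 0) h
  simp [e0] at this

/-- The test flow `u(t, x) = t² · e₀` (space-constant, accelerating); pressure `p ≡ 0`.
[cite: UmarBisandu2025NSMinimumForce, (1) p.2] -/
def uAcc (t : ℝ) (_x : EuclideanSpace ℝ (Fin 3)) : EuclideanSpace ℝ (Fin 3) := (t ^ 2) • e0

/-- The test flow is smooth on `[0,∞) × ℝ³`. [cite: UmarBisandu2025NSMinimumForce, (1) p.2] -/
theorem isSmoothOnHalfSpace_uAcc : IsSmoothOnHalfSpace uAcc := by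
  have h : Function.uncurry uAcc = fun q : ℝ × EuclideanSpace ℝ (Fin 3) => (q.1 ^ 2) • e0 := by
    funext q; rfl
  rw [IsSmoothOnHalfSpace, h]
  exact ((contDiff_fst.pow 2).smul contDiff_const).contDiffOn

/-- The momentum force of the test flow: `ρ Du/Dt = ρ·2t·e₀` (the convective part vanishes, the field being constant
in space). [cite: UmarBisandu2025NSMinimumForce, (1) p.2; Lemma 1 (10) p.3] -/
theorem momentumForce_uAcc (ρ t : ℝ) (ht : 0 ≤ t) (x : EuclideanSpace ℝ (Fin 3)) :
    momentumForce ρ uAcc t x = (ρ * (2 * t)) • e0 := by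
  unfold momentumForce
  have hd : derivWithin (fun s => uAcc s x) (Ici 0) t = (2 * t) • e0 := by
    have h1 : HasDerivAt (fun s : ℝ => (s ^ 2) • e0) (((2 : ℕ) * t ^ (2 - 1)) • e0) t :=
      (hasDerivAt_pow 2 t).smul_const e0
    have h2 := (h1.hasDerivWithinAt (s := Ici 0)).derivWithin (uniqueDiffOn_Ici 0 t ht)
    simpa [uAcc] using h2
  have hf : fderiv ℝ (uAcc t) x (uAcc t x) = 0 := by
    have : uAcc t = fun _ : EuclideanSpace ℝ (Fin 3) => (t ^ 2) • e0 := rfl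
    rw [this, fderiv_fun_const]
    rfl
  rw [hd, hf, add_zero, smul_smul]

/-- **Step 1 is false** (Preliminaries p. 2 + Lemma 1 (10)–(12) p. 3 + Lemma 4 p. 4: «every force-per-volume term
of the Navier–Stokes equation is a constant `(1/F₀)[n_Ω − C_Ω]`»): for `u(t,x) = t²·e₀`, `p ≡ 0`, `ρ = μ = 1`, the
momentum force `ρ Du/Dt = 2t·e₀` equals `0` at `t = 0` and `2e₀ ≠ 0` at `t = 1`, so no constant `cB` serves.
[claim: UmarBisandu2025NSMinimumForce, status: disputed] -/
theorem not_Step1_MinimumForce : ¬ Literature.Claims.NS.UmarBisandu2025.Step1_MinimumForce := by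
  intro h
  obtain ⟨⟨cB, hcB⟩, -, -⟩ :=
    h 1 1 uAcc 0 one_pos one_pos isSmoothOnHalfSpace_uAcc isSmoothOnHalfSpace_zero
  have h0 := hcB 0 le_rfl 0
  have h1 := hcB 1 zero_le_one 0
  rw [momentumForce_uAcc 1 0 le_rfl] at h0
  rw [momentumForce_uAcc 1 1 zero_le_one] at h1
  have : (2 : ℝ) • e0 = 0 := by
    have h01 : ((1 : ℝ) * (2 * 1)) • e0 = ((1 : ℝ) * (2 * 0)) • e0 := by rw [h1, h0]
    simpa using h01
  exact e0_ne_zero (by simpa using this)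

/-- **The bridge holds vacuously** (title / p. 2 l. 268–274 / CONCLUDING REMARKS p. 19: typed
`Step1_MinimumForce ∧ Step2_ExplicitField → ClaimedTheorem`): Step 1 being false, the printed chain
`claim_of_steps` transmits nothing to the claimed periodic (B)-statement (logic record; skeleton
`step3_of_not_step1`). [cite: UmarBisandu2025NSMinimumForce, p.2 l.268–274; p.19 l.337–343] -/
theorem step3_Bridge_holds : Literature.Claims.NS.UmarBisandu2025.Step3_Bridge :=
  step3_of_not_step1 not_Step1_MinimumForce

end Summit.NavierStokesRegularity.NavierStokesRegularity.Theorems.UmarBisandu2025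

end
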